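import Summits.KontsevichZagierPeriods.KontsevichZagierPeriods.Theses.SymplecticScissors
import Literature.NumberTheory.Transcendental.KZSemiCanonicalReductionProofs
import Literature.NumberTheory.Transcendental.KZLogCalculusProofs

/-!
# Signed sweep of the triangle, helper III: the trace and image representations

Helper file for the stub `stub_signedSweep` of the line `twist-restoring-shear` (crux
`PlanarCompiler`, route `SymplecticScissors`). For `A` `ℚ`-semialgebraic and continuous on the
closed triangle `Δ` we build

* the 1-dimensional trace representation `[∫_{(u,v)} A(t, f t) dt]` along a `ℚ`-semialgebraic
  section `f` whose graph over `(u, v)` lies in `Δ` (composition of semialgebraic maps; a bounded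
  measurable integrand on a bounded interval is integrable);
* the planar integrand-`1` representation on the image `Ψ(C)` of a `ℚ`-semialgebraic `C ⊆ Δ` under
  a shear `Ψ p = (p i, A p)` (Tarski–Seidenberg image; bounded, hence of finite area;
  `KZ.exists_oneRep`).
-/

noncomputable section

open MeasureTheory Set Filter Topology
open Literature.NumberTheory.Transcendental Literature.ModelTheory.ExponentialFields

namespace Summit.KontsevichZagierPeriods.SymplecticScissors.PlanarCompilerProof

/-- The closed standard triangle is compact, and lies in the unit square. [folklore] -/
theorem isCompact_closedTriangle :
    IsCompact {p : Fin 2 → ℝ | 0 ≤ p 0 ∧ 0 ≤ p 1 ∧ p 0 + p 1 ≤ 1} ∧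
      ∀ p ∈ {p : Fin 2 → ℝ | 0 ≤ p 0 ∧ 0 ≤ p 1 ∧ p 0 + p 1 ≤ 1}, ∀ i, 0 ≤ p i ∧ p i ≤ 1 := by
  have hsq : ∀ p ∈ {p : Fin 2 → ℝ | 0 ≤ p 0 ∧ 0 ≤ p 1 ∧ p 0 + p 1 ≤ 1}, ∀ i, 0 ≤ p i ∧ p i ≤ 1 := by
    intro p hp i
    simp only [mem_setOf_eq] at hp
    fin_cases i
    · exact ⟨hp.1, by simp; linarith⟩
    · exact ⟨hp.2.1, by simp; linarith⟩
  refine ⟨?_, hsq⟩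
  have hcl : IsClosed {p : Fin 2 → ℝ | 0 ≤ p 0 ∧ 0 ≤ p 1 ∧ p 0 + p 1 ≤ 1} := by
    refine (isClosed_le continuous_const (continuous_apply 0)).inter
      ((isClosed_le continuous_const (continuous_apply 1)).inter ?_)
    exact isClosed_le ((continuous_apply 0).add (continuous_apply 1)) continuous_const
  refine (isCompact_Icc (a := (0 : Fin 2 → ℝ)) (b := 1)).of_isClosed_subset hcl ?_
  intro p hp
  exact ⟨fun i => (hsq p hp i).1, fun i => (hsq p hp i).2⟩

/-- A continuous function on the closed triangle is bounded there. [folklore] -/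
theorem exists_bound_closedTriangle {A : (Fin 2 → ℝ) → ℝ}
    (hAc : ContinuousOn A {p : Fin 2 → ℝ | 0 ≤ p 0 ∧ 0 ≤ p 1 ∧ p 0 + p 1 ≤ 1}) :
    ∃ M : ℝ, ∀ p ∈ {p : Fin 2 → ℝ | 0 ≤ p 0 ∧ 0 ≤ p 1 ∧ p 0 + p 1 ≤ 1}, |A p| ≤ M := by
  obtain ⟨M, hM⟩ := isCompact_closedTriangle.1.exists_bound_of_continuousOn hAc
  exact ⟨M, fun p hp => by simpa [Real.norm_eq_abs] using hM p hp⟩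

/-- **The trace representation** `[∫_{(u,v)} A(t, f t) dt]`: for `A` `ℚ`-semialgebraic and
continuous on the closed triangle and a section `f`, `ℚ`-semialgebraic on `(u, v)` with graph in the
closed triangle, the function `z ↦ A (z 0, f (z 0))` is a `ℚ`-semialgebraic integrable integrand
on `{z | z 0 ∈ (u, v)}`. [folklore] -/
theorem stub_signedSweep_traceRep :
    ∀ {A : (Fin 2 → ℝ) → ℝ},
    IsSemialgebraicFunOn ℚ {p : Fin 2 → ℝ | 0 ≤ p 0 ∧ 0 ≤ p 1 ∧ p 0 + p 1 ≤ 1} A →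
    ContinuousOn A {p : Fin 2 → ℝ | 0 ≤ p 0 ∧ 0 ≤ p 1 ∧ p 0 + p 1 ≤ 1} → ∀ {u v : ℝ} {f : ℝ → ℝ},
    IsSemialgebraicFunOn ℚ {z : Fin 1 → ℝ | z 0 ∈ Ioo u v} (fun z => f (z 0)) →
    (∀ t ∈ Ioo u v, (![t, f t] : Fin 2 → ℝ) ∈ {p : Fin 2 → ℝ | 0 ≤ p 0 ∧ 0 ≤ p 1 ∧ p 0 + p 1 ≤ 1}) →
    ∃ ρ : KZ.IntegralRep 1, ρ.domain = {z : Fin 1 → ℝ | z 0 ∈ Ioo u v} ∧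
      ∀ z ∈ ρ.domain, ρ.integrand z = A ![z 0, f (z 0)] := by
  intro A hA hAc u v f hf hfΔ
  set dom : Set (Fin 1 → ℝ) := {z : Fin 1 → ℝ | z 0 ∈ Ioo u v} with hdom
  have hdom_sa : IsSemialgebraic ℚ dom := IsSemialgebraicFunOn.isSemialgebraic_holds hf
  -- the map `z ↦ (z 0, f (z 0))` is semialgebraic on `dom` and lands in the closed triangle
  have hφ : IsSemialgebraicMapOn ℚ dom (fun z : Fin 1 → ℝ => (![z 0, f (z 0)] : Fin 2 → ℝ)) := by
    refine IsSemialgebraicMapOn.of_forall hdom_sa fun j => ?_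
    fin_cases j
    · simpa using Literature.NumberTheory.Transcendental.isSemialgebraicFunOn_apply hdom_sa 0
    · simpa using hf
  have hmaps : MapsTo (fun z : Fin 1 → ℝ => (![z 0, f (z 0)] : Fin 2 → ℝ)) dom
      {p : Fin 2 → ℝ | 0 ≤ p 0 ∧ 0 ≤ p 1 ∧ p 0 + p 1 ≤ 1} := fun z hz => hfΔ (z 0) hz
  have hg : IsSemialgebraicFunOn ℚ dom (fun z : Fin 1 → ℝ => A ![z 0, f (z 0)]) :=
    IsSemialgebraicFunOn.comp_isSemialgebraicMapOn_holds hA hφ hmaps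
  -- integrability: bounded measurable integrand on a set of finite measure
  obtain ⟨M, hM⟩ := exists_bound_closedTriangle hAc
  have hmeas : MeasurableSet dom := IsSemialgebraic.measurableSet_holds hdom_sa
  have hbdd : Bornology.IsBounded dom := by
    refine (Metric.isBounded_Icc (fun _ : Fin 1 => u) (fun _ : Fin 1 => v)).subset fun z hz => ?_
    have hz' : z 0 ∈ Ioo u v := hz
    refine ⟨fun i => ?_, fun i => ?_⟩
    · rw [Subsingleton.elim i 0]; exact hz'.1.le
    · rw [Subsingleton.elim i 0]; exact hz'.2.le
  have hfin : volume dom < ⊤ := hbdd.measure_lt_top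
  have hint : IntegrableOn (fun z : Fin 1 → ℝ => A ![z 0, f (z 0)]) dom volume := by
    refine ⟨KZ.aestronglyMeasurable_of_isSemialgebraicFunOn hg hmeas, ?_⟩
    refine HasFiniteIntegral.restrict_of_bounded (C := M) hfin ?_
    refine ae_restrict_of_forall_mem hmeas fun z hz => ?_
    rw [Real.norm_eq_abs]
    exact hM _ (hmaps hz)
  exact ⟨⟨dom, fun z => A ![z 0, f (z 0)], hdom_sa, hg, hint⟩, rfl, fun z _ => rfl⟩

/-- **The sheared image as a planar set.** For `A` `ℚ`-semialgebraic and continuous on the closed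
triangle `Δ` and a `ℚ`-semialgebraic `C ⊆ Δ`, the image of `C` under the shear `p ↦ (p i, A p)` is
a `ℚ`-semialgebraic set of finite area (Tarski–Seidenberg; it is bounded), so it carries an
integrand-`1` representation. [folklore] -/
theorem exists_imageRep {A : (Fin 2 → ℝ) → ℝ}
    (hA : IsSemialgebraicFunOn ℚ {p : Fin 2 → ℝ | 0 ≤ p 0 ∧ 0 ≤ p 1 ∧ p 0 + p 1 ≤ 1} A)
    (hAc : ContinuousOn A {p : Fin 2 → ℝ | 0 ≤ p 0 ∧ 0 ≤ p 1 ∧ p 0 + p 1 ≤ 1}) (i : Fin 2)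
    {C : Set (Fin 2 → ℝ)} (hC : IsSemialgebraic ℚ C)
    (hCΔ : C ⊆ {p : Fin 2 → ℝ | 0 ≤ p 0 ∧ 0 ≤ p 1 ∧ p 0 + p 1 ≤ 1}) :
    ∃ r : KZ.IntegralRep 2, r.domain = (fun p : Fin 2 → ℝ => (![p i, A p] : Fin 2 → ℝ)) '' C ∧
      r.integrand = fun _ => 1 := by
  have hφ : IsSemialgebraicMapOn ℚ C (fun p : Fin 2 → ℝ => (![p i, A p] : Fin 2 → ℝ)) := by
    refine IsSemialgebraicMapOn.of_forall hC fun j => ?_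
    fin_cases j
    · simpa using Literature.NumberTheory.Transcendental.isSemialgebraicFunOn_apply hC i
    · simpa using hA.mono hCΔ hC
  have himg : IsSemialgebraic ℚ ((fun p : Fin 2 → ℝ => (![p i, A p] : Fin 2 → ℝ)) '' C) :=
    IsSemialgebraicMapOn.isSemialgebraic_image_holds hφ Subset.rfl hC
  obtain ⟨M, hM⟩ := exists_bound_closedTriangle hAc
  have hbdd : Bornology.IsBounded ((fun p : Fin 2 → ℝ => (![p i, A p] : Fin 2 → ℝ)) '' C) := by
    refine (Metric.isBounded_Icc (![0, -M] : Fin 2 → ℝ) ![1, M]).subset ?_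
    rintro _ ⟨p, hp, rfl⟩
    have hsq := isCompact_closedTriangle.2 p (hCΔ hp) i
    have hAM := abs_le.1 (hM p (hCΔ hp))
    refine ⟨fun j => ?_, fun j => ?_⟩
    · fin_cases j
      · simpa using hsq.1
      · simpa using hAM.1
    · fin_cases j
      · simpa using hsq.2
      · simpa using hAM.2
  exact KZ.exists_oneRep himg hbdd.measure_lt_top.ne

end Summit.KontsevichZagierPeriods.SymplecticScissors.PlanarCompilerProof
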